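import Summits.BirchSwinnertonDyer.BirchSwinnertonDyer.Theses.EisensteinPrimes
import Summits.BirchSwinnertonDyer.BirchSwinnertonDyer.Theorems.EisensteinPrimesMazurMCOnCellBThm114Parity
import Summits.BirchSwinnertonDyer.BirchSwinnertonDyer.Theorems.EisensteinPrimesMazurMCOnCellBLocate
import Summits.BirchSwinnertonDyer.Rank1Residual.X2.IsogenyClassStability
import Summits.BirchSwinnertonDyer.Rank1Residual.X2.RankOneHeegnerExact
import Literature.NumberTheory.EllipticCurves.TateCurve.NumberFieldUniformization
import Literature.NumberTheory.EllipticCurves.TateCurve.NumberFieldUniformizationTwisted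
import HarnessLib

/-!
# Crux `MazurMCOnCellB` (stmt-BirchSwinnertonDyer-19033), line `mudescent` v4 — the crux BY NAME with
# Greenberg's Thm. 1.14 in place of stub 1b (Prop. 3.10): the h310-free composition

LEAD bsd-line-x2-p1 g3 (2026-08-28); companion of `…MazurMCOnCellBThm114Parity` (route-independent
parity door). The registered skeleton v4 (sha256 `460ece00…`) composes the crux from stub 1
(`EisensteinPrimes.PublishedInputs`), stub 1b (`Greenberg1999.prop310_selmerCorank_mod_two_eq_lambdaInvariant`),
stub 3′ (`stub_muPart_offLocus`) and stub 4″ (`stub_lambdaCountWeak_offLocus`); its tree form is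
`…MudescentV4.mazurMCOnCellB_of_muPart_offLocus_of_lambdaCountWeak_offLocus` (p612961). THIS FILE:

* `mazurMCOnCellB_of_thm114_of_muPart_offLocus_of_lambdaCountWeak_offLocus` — the SAME composition with
  stub 1b replaced by Greenberg's Thm. 1.14 (`Greenberg1999_thm114_charIdeal_iota_invariant`, ι-invariance
  of `char X`, cite-only PUB, already carried by LINE 9 on crux `SchneiderAtThree` and by the X5 doors):
  DESCEND (`stub_locate`, p443911) → `X2.CellB` transport → at the étale end the Thm-1.14 iff
  `…Thm114Parity.cellB_mazurMainConjectureAt_iff_muPart_and_lambdaCountWeak_of_thm114` (parity of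
  `λ_alg` from Thm. 1.14 + Stein–Wuthrich Thm. 6.1 + GZK, parity of `λ_an` from the Mazur–Tate–Teitelbaum
  functional equation) → ASCEND (`X2.mazurMainConjectureAt_of_isIsogenous`). Every named input other
  than Thm. 1.14 is a conjunct of `PublishedInputs` (2, 5, 6, 11, 15–20).
* `mazurMCOnCellB_iff_forall_offLocus_weak_of_thm114` — granted `PublishedInputs` + Thm. 1.14, the crux
  ⟺ (stub 3′ ∧ stub 4″ at every X2b étale end): skeleton v4 stays EQUIVALENT to the crux under the
  alternative fact basket `PublishedInputs ∪ {Thm. 1.14}` (host RULING L111: «Prop. 3.10 OR Thm. 1.14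
  (either PUB) suffices as the cite-only parity input» of row A10; no re-registration).

HONEST FRAMING: the two OPEN stubs 3′/4″ (jointly the crux; Mazur's MC reverse divisibility at type-A
multiplicative `p`, open in print) are hypotheses here exactly as in p612961; Thm. 1.14 and the
`PublishedInputs` conjuncts are hypotheses BY NAME; no main conjecture / BSD is proved for any curve;
0 cells / 0 labels move. This file imports the route file (and `…Locate`, p443911) because it concludes
the crux BY NAME — the same, inherent theses-cone footprint as p612961; the parity door itself is
route-independent.

References: [GreenbergLNM1716] Thm. 1.14 (p. 68), Prop. 3.10 (p. 82), Conj. 1.11 (p. 58);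
[Wuthrich2014] Thm. 16, Lemma 17 (p. 397); [SteinWuthrich2013] Thm. 6.1; [PerrinRiou1989Isogenie]
Théorème (p. 349); [MazurTateTeitelbaum1986Invent] §I.17.
-/

set_option autoImplicit false

-- `Summit.BirchSwinnertonDyer.BirchSwinnertonDyer.…`: the summit and its single sub-problem share a name.
set_option linter.dupNamespace false

noncomputable section

open scoped Classical MatrixGroups ModularForm

open PowerSeries CongruenceSubgroup WeierstrassCurve
  Literature.NumberTheory.EllipticCurves
  Literature.NumberTheory.EllipticCurves.ModularForms
  Literature.NumberTheory.EllipticCurves.Rank1Residual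
  Literature.NumberTheory.EllipticCurves.Wuthrich2014
  Literature.NumberTheory.EllipticCurves.Greenberg1999
  Literature.NumberTheory.EllipticCurves.SteinWuthrich2013
  Summit.BirchSwinnertonDyer.Rank1Residual
  Summit.BirchSwinnertonDyer.Rank1Residual.X1.MuLambda
  Summit.BirchSwinnertonDyer.Rank1Residual.X1.TamagawaSqueeze
  Summit.BirchSwinnertonDyer.BirchSwinnertonDyer.Theses
  Summit.BirchSwinnertonDyer.BirchSwinnertonDyer.Theorems.EisensteinPrimesMazurMCOnCellBThm114Parity

open Literature.Barriers.BirchSwinnertonDyer (HasRamifiedOddLineAt)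

namespace Summit.BirchSwinnertonDyer.BirchSwinnertonDyer.Theorems.EisensteinPrimesMazurMCOnCellBThm114Door

/-- **Line `mudescent` v4 composed with Thm. 1.14 instead of Prop. 3.10: the crux BY NAME.** Stub 1
(`EisensteinPrimes.PublishedInputs`) ∧ Greenberg Thm. 1.14 (`Greenberg1999_thm114_charIdeal_iota_invariant`)
∧ stub 3′ (the μ-part `μ(G) ≤ μ(g)` for every cyclotomic datum at every X2b étale end) ∧ stub 4″ (the
weak λ-count at every X2b étale end) ⇒ `EisensteinPrimes.MazurMCOnCellB`. DESCEND (`stub_locate`,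
p443911), transport `X2.CellB` (Tate uniformisation facts discharged), the Thm-1.14 iff of
`…Thm114Parity` at `(W₀, p)`, ASCEND (`X2.mazurMainConjectureAt_of_isIsogenous`). Compare
`…MudescentV4.mazurMCOnCellB_of_muPart_offLocus_of_lambdaCountWeak_offLocus` (same, with `h310`).
[cite: GreenbergLNM1716, Thm. 1.14 (p. 68), Conj. 1.11 and p. 58 ([Sch3], [Pe2])]
[cite: PerrinRiou1989Isogenie, Théorème (p. 349)] [cite: Wuthrich2014, Thm. 16 and Lemma 17 (p. 397)] -/
theorem mazurMCOnCellB_of_thm114_of_muPart_offLocus_of_lambdaCountWeak_offLocus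
    (hP : EisensteinPrimes.PublishedInputs)
    (h114 : Greenberg1999_thm114_charIdeal_iota_invariant)
    (hμ : ∀ (W₀ : WeierstrassCurve ℚ) [W₀.IsElliptic] [W₀.IsGloballyMinimal] (p : ℕ) [Fact p.Prime],
      X2.CellB W₀ p → ¬ HasRamifiedOddLineAt W₀ p →
      ∀ (κ : ZpExtension ℚ p) (γ : Field.absoluteGaloisGroup ℚ),
        κ.IsCyclotomic → κ.IsTopGenerator γ → IsCyclotomicVariable p γ →
        ∀ {N : ℕ} [NeZero N] (f : CuspForm (Gamma0 N) 2), IsNewformOf W₀ f →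
        ∀ (ϖ : ℚ), (ϖ : ℝ) * W₀.realPeriodRat = plusPeriod f →
        ∀ (L : PowerSeries ℚ_[p]),
          (W₀.HasSplitMultiplicativeReductionAtPrime p → IsSplitMultPAdicLFunctionOf f p L) →
          (¬ W₀.HasSplitMultiplicativeReductionAtPrime p → IsMultPAdicLFunctionOf f p (-1) L) →
        ∀ (D : W₀.SelmerDualData κ γ) (g G : IwasawaAlgebra p), D.charIdeal = Ideal.span {g} →
          iwasawaToPowerSeries p G = PowerSeries.C ((ϖ : ℚ) : ℚ_[p]) * L → mu G ≤ mu g)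
    (hl : ∀ (W₀ : WeierstrassCurve ℚ) [W₀.IsElliptic] [W₀.IsGloballyMinimal] (p : ℕ) [Fact p.Prime],
      X2.CellB W₀ p → ¬ HasRamifiedOddLineAt W₀ p →
        ∃ n k : ℕ, X2.AnalyticLambdaEq W₀ p n ∧ AlgebraicLambdaGE W₀ p k ∧
          (¬ W₀.HasSplitMultiplicativeReductionAtPrime p → n ≤ k + 1) ∧
          (W₀.HasSplitMultiplicativeReductionAtPrime p → n ≤ k + 2)) :
    EisensteinPrimes.MazurMCOnCellB := by
  have hCassels := hP.2.1
  have hpar := hP.2.2.2.2.1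
  have hnf := hP.2.2.2.2.2.1
  have hGZK := hP.2.2.2.2.2.2.2.2.2.2.1
  have hWu := hP.2.2.2.2.2.2.2.2.2.2.2.2.2.2.1
  have hJs := hP.2.2.2.2.2.2.2.2.2.2.2.2.2.2.2.1
  have hJn := hP.2.2.2.2.2.2.2.2.2.2.2.2.2.2.2.2.1
  have hHs := hP.2.2.2.2.2.2.2.2.2.2.2.2.2.2.2.2.2.1
  have hHn := hP.2.2.2.2.2.2.2.2.2.2.2.2.2.2.2.2.2.2.1
  have hGS := hP.2.2.2.2.2.2.2.2.2.2.2.2.2.2.2.2.2.2.2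
  unfold EisensteinPrimes.MazurMCOnCellB
  intro W _ _ p _ hc
  -- DESCEND
  obtain ⟨W₀, _, _, hiso, hoff⟩ := EisensteinPrimesMazurMCOnCellBLocate.stub_locate W p hc
  have hc₀ : X2.CellB W₀ p :=
    (X2.cellB_iff_of_isIsogenous (p := p) TateCurve.Silverman1994_thmV53_tateUniformisation_holds
      TateCurve.Silverman1994_thmV53_corV54_tateUniformisation_holds hiso).mp hc
  have hp2 : p ≠ 2 := hc₀.2.1.1
  have hred₀ : ¬ W₀.HasIrreducibleModPGaloisRep p := hc₀.2.1.2.1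
  have hmult₀ : W₀.HasMultiplicativeReductionAtPrime p := hc₀.2.1.2.2
  have hr₀ : W₀.analyticRank = 0 := hc₀.1
  -- the v4 stubs at the étale end give MC at `(W₀, p)`, the parity of `λ_alg` from Thm. 1.14
  have hMC₀ : X2.MazurMainConjectureAt W₀ p :=
    (cellB_mazurMainConjectureAt_iff_muPart_and_lambdaCountWeak_of_thm114 hWu h114 hJs hJn hHs hHn hGZK
      hpar (hGS W₀ p) hc₀).mpr ⟨hμ W₀ p hc₀ hoff, hl W₀ p hc₀ hoff⟩
  -- ASCEND along `W₀ ∼ W`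
  exact X2.mazurMainConjectureAt_of_isIsogenous hWu hJs hJn hHs hHn hGZK hnf hpar hCassels hGS
    hiso.symm_of_charZero p hp2 hmult₀ hred₀ hr₀ hMC₀

/-- **Skeleton v4 ⟺ the crux under the basket `PublishedInputs ∪ {Thm. 1.14}`.** Granted
`EisensteinPrimes.PublishedInputs` and Greenberg's Thm. 1.14: `MazurMCOnCellB ⟺ ∀ X2b pairs (W₀, p)`
OFF the locus `HasRamifiedOddLineAt`, stub 3′(W₀, p) ∧ stub 4″(W₀, p). `→`: the Thm-1.14 iff of
`…Thm114Parity` at `W₀` itself; `←`: `mazurMCOnCellB_of_thm114_of_muPart_offLocus_of_lambdaCountWeak_offLocus`.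
Compare `…MudescentV4.mazurMCOnCellB_iff_forall_offLocus_weak` (same, with Prop. 3.10).
[cite: GreenbergLNM1716, Thm. 1.14 (p. 68) and Prop. 3.10 (p. 82)] [cite: Wuthrich2014, Thm. 16 and Lemma 17 (p. 397)]
[cite: MazurTateTeitelbaum1986Invent, §I.17] -/
theorem mazurMCOnCellB_iff_forall_offLocus_weak_of_thm114 (hP : EisensteinPrimes.PublishedInputs)
    (h114 : Greenberg1999_thm114_charIdeal_iota_invariant) :
    EisensteinPrimes.MazurMCOnCellB ↔
      ∀ (W₀ : WeierstrassCurve ℚ) [W₀.IsElliptic] [W₀.IsGloballyMinimal] (p : ℕ) [Fact p.Prime],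
        X2.CellB W₀ p → ¬ HasRamifiedOddLineAt W₀ p →
        ((∀ (κ : ZpExtension ℚ p) (γ : Field.absoluteGaloisGroup ℚ),
          κ.IsCyclotomic → κ.IsTopGenerator γ → IsCyclotomicVariable p γ →
          ∀ {N : ℕ} [NeZero N] (f : CuspForm (Gamma0 N) 2), IsNewformOf W₀ f →
          ∀ (ϖ : ℚ), (ϖ : ℝ) * W₀.realPeriodRat = plusPeriod f →
          ∀ (L : PowerSeries ℚ_[p]),
            (W₀.HasSplitMultiplicativeReductionAtPrime p → IsSplitMultPAdicLFunctionOf f p L) →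
            (¬ W₀.HasSplitMultiplicativeReductionAtPrime p → IsMultPAdicLFunctionOf f p (-1) L) →
          ∀ (D : W₀.SelmerDualData κ γ) (g G : IwasawaAlgebra p), D.charIdeal = Ideal.span {g} →
            iwasawaToPowerSeries p G = PowerSeries.C ((ϖ : ℚ) : ℚ_[p]) * L → mu G ≤ mu g) ∧
        ∃ n k : ℕ, X2.AnalyticLambdaEq W₀ p n ∧ AlgebraicLambdaGE W₀ p k ∧
          (¬ W₀.HasSplitMultiplicativeReductionAtPrime p → n ≤ k + 1) ∧
          (W₀.HasSplitMultiplicativeReductionAtPrime p → n ≤ k + 2)) := by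
  have hpar := hP.2.2.2.2.1
  have hGZK := hP.2.2.2.2.2.2.2.2.2.2.1
  have hWu := hP.2.2.2.2.2.2.2.2.2.2.2.2.2.2.1
  have hJs := hP.2.2.2.2.2.2.2.2.2.2.2.2.2.2.2.1
  have hJn := hP.2.2.2.2.2.2.2.2.2.2.2.2.2.2.2.2.1
  have hHs := hP.2.2.2.2.2.2.2.2.2.2.2.2.2.2.2.2.2.1
  have hHn := hP.2.2.2.2.2.2.2.2.2.2.2.2.2.2.2.2.2.2.1
  have hGS := hP.2.2.2.2.2.2.2.2.2.2.2.2.2.2.2.2.2.2.2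
  refine ⟨fun h W₀ _ _ p _ hc₀ _ ↦
    (cellB_mazurMainConjectureAt_iff_muPart_and_lambdaCountWeak_of_thm114 hWu h114 hJs hJn hHs hHn hGZK
      hpar (hGS W₀ p) hc₀).mp (by unfold EisensteinPrimes.MazurMCOnCellB at h; exact h W₀ p hc₀),
    fun h ↦ ?_⟩
  exact mazurMCOnCellB_of_thm114_of_muPart_offLocus_of_lambdaCountWeak_offLocus hP h114
    (fun W₀ _ _ p _ hc₀ hoff ↦ (h W₀ p hc₀ hoff).1) (fun W₀ _ _ p _ hc₀ hoff ↦ (h W₀ p hc₀ hoff).2)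

end Summit.BirchSwinnertonDyer.BirchSwinnertonDyer.Theorems.EisensteinPrimesMazurMCOnCellBThm114Door

end
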